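import Summits.BirchSwinnertonDyer.BirchSwinnertonDyer.Theorems.PrintCf2SplitBadTwoKummerBranchDichotomy
import Summits.BirchSwinnertonDyer.BirchSwinnertonDyer.Theorems.PrintCf2SplitBadTwoCMShaEigenMiddleFactorSel
import HarnessLib

/-!
# Crux `PrintCf2.SplitBadTwoRankOneOfFacts` (item stmt-BirchSwinnertonDyer-20368), road α, S3c₂: the Selmer-level CM input (H1-Sel) DECIDED BY
# THE GLOBAL FINITENESS `hfinB′` — -w3 g9's dichotomy-and-exclusion run on `Q = res_⊤(Sel_{p^∞}(E_K/K))`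

Cell `bsd-print-cf2`, width seat `bsd-line-cf2-p1-w8` g2 (brick **B6h**, part 2); `--supports stmt-BirchSwinnertonDyer-20368` (helper,
Theses-free). HONEST FRAMING: nothing here closes a crux or a stub; BSD is not proved by any of this; no summit statement is proved by this
seat. No definition, no named fact, no `sorry`. beyond-print theorem: no.

WHAT. p672681/p673037 reduce (F2) ∧ (H1′) of (R-BV) to (H1-Sel) «the `E[𝔮_r^∞]`-component of every SELMER class dies on `D_v`». -w3 g9's
`KummerBranchDichotomy` (p671916) decides the analogous statement for the global KUMMER image by a dichotomy (cyclic local `p`-torsion) and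
an exclusion (the other branch would make an infinite group sit inside the finite `𝔖_v(K, E[𝔮_{r′}^∞])`). Here the same argument is run on
`Q = res_⊤(Sel_{p^∞}(E_K/K))`:
* (S) for `Q` is a THEOREM: `ι_* e_* res_⊤ y₀ ∈ res_⊤ Sel` (-w7 g2 `resH1Hom_subtype_proj_mem_map_resSubgroup_selmer`, `π_*` preserves `Sel`);
* `comap_sel_le_ker_resOfLe_of_not_mem` — the `E[𝔮^∞]`-components of Selmer classes are locally zero at `w ∤ p` (-w7 g2 p664118 + eigen-projector);
* **`sel_input_of_finite_conj`** — (H1-Sel) ⟸ `hfinB′ : Finite 𝔖_v(K, E[𝔮_{1−r}^∞])` ∧ (INF′) `¬ Finite (ι′_*⁻¹ res_⊤(range κ))` (the conjugate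
  summand carries infinitely many global Kummer classes) ∧ (T-loc-Sel) «`loc_v(res_⊤ Sel)` has cyclic `p`-torsion» (it sits in the local Kummer
  image `E(K_v) ⊗ ℚ_p/ℤ_p`, whose `p`-torsion is `ℤ/p` for `K_v = ℚ_p`). No formal group, no projector data in the statement.
So, with p673037: (F2) ∧ (H1′) ⟸ hfinB′ ∧ (INF′) ∧ (T-loc-Sel) — a GLOBAL alternative to the local input (H1-pts) of p670747.

References: A. Agboola, Compositio 143 (2007) §3, §6 [Agboola2007]; R. Greenberg, LNM 1716 (1999) §2 Prop. 2.1 [GreenbergLNM1716]; K. Rubin,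
LNM 1716 (1999) §2 [Rubin1999]; J.-P. Serre, *Galois Cohomology* I §2.4 [SerreGaloisCohomology1997].
-/

noncomputable section

open scoped Classical

set_option linter.dupNamespace false
set_option autoImplicit false

open NumberField IsDedekindDomain Field WeierstrassCurve
open Literature.NumberTheory.EllipticCurves Literature.NumberTheory.EllipticCurves.GreenbergSelmer
open Literature.NumberTheory.EllipticCurves.Castella2018.AcSelmer
open Literature.NumberTheory.EllipticCurves.Agboola2007
open Literature.NumberTheory.EllipticCurves.ResKernel
open Literature.NumberTheory.GaloisRepresentations
open Summit.BirchSwinnertonDyer.BirchSwinnertonDyer.Theorems.PrintCf2.RestrictedSelmerPair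

universe u

namespace Summit.BirchSwinnertonDyer.BirchSwinnertonDyer.Theorems.PrintCf2.CMPrimes

section Generic

variable {K : Type u} [Field K] [NumberField K] (V : WeierstrassCurve K) [V.IsElliptic] (p : ℕ) [Fact p.Prime]
  (π : V.endRing) (r r' : ℤ_[p]) (v : HeightOneSpectrum (𝓞 K))

/-- **The `E[𝔮_r^∞]`-components of Selmer classes are locally zero at `w ∤ p`**: `ι_*⁻¹(res_⊤ Sel) ≤ ker res_{⊤ ⊓ D_w}` (Selmer classes are
classical at `w`, classical = locally trivial at `w ∤ p` (-w7 g2 p664118), and `ι_*` is injective on `H¹(⊤ ⊓ D_w, ·)`).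
[cite: GreenbergLNM1716, §2 Prop. 2.1] [cite: Agboola2007, §3 (arXiv p0008:L8–12)] -/
theorem comap_sel_le_ker_resOfLe_of_not_mem
    (hinf : V.endEigenPrimaryTorsion p π r ⊓ V.endEigenPrimaryTorsion p π r' = ⊥)
    (hsup : V.endEigenPrimaryTorsion p π r ⊔ V.endEigenPrimaryTorsion p π r' = ⊤)
    (w : HeightOneSpectrum (𝓞 K)) (hw : ((p : ℕ) : 𝓞 K) ∉ w.asIdeal) :
    ((V.selmerGroupPInfty p).map (resSubgroup ⊤ (V.geomPrimaryTorsion p))).comap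
        (resH1Hom (ContinuousMonoidHom.id _) (V.endEigenPrimaryTorsion p π r).subtype (fun _ _ ↦ rfl)) ≤
      (resOfLe ↥(V.endEigenPrimaryTorsion p π r) (inf_le_left : ⊤ ⊓ decomp w ≤ ⊤)).ker := by
  intro c hc
  obtain ⟨y₀, hy₀, hy⟩ := AddSubgroup.mem_map.mp (AddSubgroup.mem_comap.mp hc)
  have hclass : resH1Hom (ContinuousMonoidHom.id _) (V.endEigenPrimaryTorsion p π r).subtype (fun _ _ ↦ rfl) c ∈
      V.localKerOver p ⊤ (w.adicCompletion K) := by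
    rw [← hy]
    simp only [WeierstrassCurve.selmerGroupPInfty, AddSubgroup.mem_inf, AddSubgroup.mem_iInf] at hy₀
    exact V.resSubgroup_top_mem_localKerOver (hy₀.1 w)
  exact comap_localKerOver_le_ker_resOfLe_of_not_mem V p π r r' hinf hsup w hw (AddSubgroup.mem_comap.mpr hclass)

/-- **(H1-Sel) from `hfinB′` — the branch decided by the global finiteness, at the Selmer level.** `V/K` elliptic over an imaginary
quadratic `K`, `M = E[𝔮_r^∞]`, `M′ = E[𝔮_{1−r}^∞]` complementary (`r − (1 − r)` a unit), `φ` an isogeny acting as `π`. HYPOTHESES: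
`hfin′ : Finite 𝔖_v(K, M′)`; (INF′) the conjugate summand carries infinitely many global Kummer classes, `¬ Finite (ι′_*⁻¹ res_⊤(range κ))`;
(T-loc-Sel) `loc_v(res_⊤ Sel_{p^∞})` has cyclic `p`-torsion. CONCLUSION (H1-Sel): for every Selmer class `y₀` and every decomposition
`ι_* c + ι′_* c′ = res_⊤ y₀`, `res_{⊤ ⊓ D_v} c = 0`. (Dichotomy `map_proj_le_ker_or_map_proj_le_ker_of_cyclic` of -w3 g9 on `Q = res_⊤ Sel`,
stable under `ι_* e_*` by -w7 g2; the excluded branch puts `ι′_*⁻¹ res_⊤(range κ) ≤ ι′_*⁻¹ Q` inside the finite `𝔖_v(K, M′)`.)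
[cite: Agboola2007, §3, §6 (arXiv p0014:L5)] [cite: GreenbergLNM1716, §2 Prop. 2.1] [cite: Rubin1999, §2] -/
theorem sel_input_of_finite_conj (hK : IsImaginaryQuadratic K)
    (hinf : V.endEigenPrimaryTorsion p π r ⊓ V.endEigenPrimaryTorsion p π (1 - r) = ⊥)
    (hsup : V.endEigenPrimaryTorsion p π r ⊔ V.endEigenPrimaryTorsion p π (1 - r) = ⊤) (hunit : IsUnit (r - (1 - r)))
    (φ : WeierstrassCurve.Isogeny V V) (hφ : ∀ P, φ P = (π : AddMonoid.End V.geomPoints) P)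
    (hfin' : Finite (restrictedSelmerBase ↥(V.endEigenPrimaryTorsion p π (1 - r)) p v))
    (hinf' : ¬ Finite ↥((((V.kummerMapPInfty p V.zsmul_geomPoints_surjective_holds).range).map
        (resSubgroup ⊤ (V.geomPrimaryTorsion p))).comap
        (resH1Hom (ContinuousMonoidHom.id _) (V.endEigenPrimaryTorsion p π (1 - r)).subtype (fun _ _ ↦ rfl))))
    (hcyc : ∀ x ∈ ((V.selmerGroupPInfty p).map (resSubgroup ⊤ (V.geomPrimaryTorsion p))).map
        (resOfLe (V.geomPrimaryTorsion p) (inf_le_left : ⊤ ⊓ decomp v ≤ ⊤)),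
      ∀ y ∈ ((V.selmerGroupPInfty p).map (resSubgroup ⊤ (V.geomPrimaryTorsion p))).map
        (resOfLe (V.geomPrimaryTorsion p) (inf_le_left : ⊤ ⊓ decomp v ≤ ⊤)),
      p • x = 0 → p • y = 0 → x ≠ 0 → ∃ m : ℤ, y = m • x) :
    ∀ y₀ ∈ V.selmerGroupPInfty p,
      ∀ (c : subgroupH1 (⊤ : Subgroup (absoluteGaloisGroup K)) ↥(V.endEigenPrimaryTorsion p π r))
        (c' : subgroupH1 (⊤ : Subgroup (absoluteGaloisGroup K)) ↥(V.endEigenPrimaryTorsion p π (1 - r))),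
        resH1Hom (ContinuousMonoidHom.id _) (V.endEigenPrimaryTorsion p π r).subtype (fun _ _ ↦ rfl) c +
            resH1Hom (ContinuousMonoidHom.id _) (V.endEigenPrimaryTorsion p π (1 - r)).subtype (fun _ _ ↦ rfl) c' =
          resSubgroup (⊤ : Subgroup (absoluteGaloisGroup K)) (V.geomPrimaryTorsion p) y₀ →
        Literature.NumberTheory.EllipticCurves.resOfLe ↥(V.endEigenPrimaryTorsion p π r) (inf_le_left : ⊤ ⊓ decomp v ≤ ⊤) c = 0 := by
  intro y₀ hy₀ c c' hdec
  -- projectors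
  obtain ⟨e, he₁, he₂, hesub, he⟩ := exists_eigenProjector V p π r (1 - r) hinf hsup
  obtain ⟨e', he'₁, he'₂, -, he'⟩ := exists_eigenProjector V p π (1 - r) r (by rw [inf_comm]; exact hinf) (by rw [sup_comm]; exact hsup)
  have hsum := coe_proj_add_coe_proj V p π r (1 - r) e e' hesub he'₁ he'₂
  -- `φ = π` acts as `r` on `M`, as `1 − r` on `M′`
  have hfr : ∀ (k : ℕ) (N : ℤ) (x : V.geomPrimaryTorsion p), x ∈ V.endEigenPrimaryTorsion p π r → p ^ k • x = 0 →
      ((N : ℤ_[p]) - r) ∈ (Ideal.span {(p : ℤ_[p]) ^ k} : Ideal ℤ_[p]) →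
        φ.toAddMonoidHom (x : V.geomPoints) = N • (x : V.geomPoints) := fun k N x hx hk hN ↦ by
    rw [show φ.toAddMonoidHom (x : V.geomPoints) = φ (x : V.geomPoints) from rfl, hφ]
    exact (eigen_of_endRing V p π r).2 k N x hx hk hN
  have hfr' : ∀ (k : ℕ) (N : ℤ) (x : V.geomPrimaryTorsion p), x ∈ V.endEigenPrimaryTorsion p π (1 - r) → p ^ k • x = 0 →
      ((N : ℤ_[p]) - (1 - r)) ∈ (Ideal.span {(p : ℤ_[p]) ^ k} : Ideal ℤ_[p]) →
        φ.toAddMonoidHom (x : V.geomPoints) = N • (x : V.geomPoints) := fun k N x hx hk hN ↦ by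
    rw [show φ.toAddMonoidHom (x : V.geomPoints) = φ (x : V.geomPoints) from rfl, hφ]
    exact (eigen_of_endRing V p π (1 - r)).2 k N x hx hk hN
  set Q := (V.selmerGroupPInfty p).map (resSubgroup ⊤ (V.geomPrimaryTorsion p)) with hQdef
  -- `Q` consists of `p`-power torsion classes
  have hQtors : ∀ q ∈ Q, ∃ N : ℕ, p ^ N • q = 0 := by
    rintro _ ⟨z, -, rfl⟩
    obtain ⟨N, hN⟩ := Summit.BirchSwinnertonDyer.BirchSwinnertonDyer.Theorems.PrintCf2.RestrictedSelmerPair.exists_pow_smul_galH1Primary_eq_zero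
      V p z
    exact ⟨N, by rw [← map_nsmul, hN, map_zero]⟩
  -- (S): `Q` is `ι_* e_*`-stable (-w7 g2)
  have hQstab : ∀ q ∈ Q, resH1Hom (ContinuousMonoidHom.id (⊤ : Subgroup (absoluteGaloisGroup K)))
      (V.endEigenPrimaryTorsion p π r).subtype (fun _ _ ↦ rfl)
      (resH1Hom (ContinuousMonoidHom.id (⊤ : Subgroup (absoluteGaloisGroup K))) e (fun σ x ↦ he σ x) q) ∈ Q := by
    rintro _ ⟨z, hz, rfl⟩
    exact resH1Hom_subtype_proj_mem_map_resSubgroup_selmer V p π r (1 - r) φ.toAddMonoidHom φ.equivariant hfr hfr' hunit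
      φ.hasLocalPointsMaps_toAddMonoidHom e e' he he' hsum hz
  rcases map_proj_le_ker_or_map_proj_le_ker_of_cyclic V p π r (1 - r) (⊤ ⊓ decomp v) e e' he₁ he he'₁ he'₂ he' hsum Q hQtors hQstab
      inf_le_left hcyc with hA | hB
  · -- the good branch: `c = e_* res_⊤ y₀ ∈ e_* Q` dies at `v`
    have hproj : resH1Hom (ContinuousMonoidHom.id (⊤ : Subgroup (absoluteGaloisGroup K))) e (fun σ x ↦ he σ x)
        (resSubgroup (⊤ : Subgroup (absoluteGaloisGroup K)) (V.geomPrimaryTorsion p) y₀) = c := by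
      rw [← hdec, map_add]
      have k1 := congrArg (fun F ↦ F c) (resH1Hom_proj_comp_subtype V p π r ⊤ e he₁ he)
      simp only [AddMonoidHom.comp_apply, AddMonoidHom.id_apply] at k1
      rw [k1, resH1Hom_proj_resH1Hom_subtype_conj_eq_zero V p π (1 - r) r ⊤ e he₂ he c', add_zero]
    exact AddMonoidHom.mem_ker.mp (hA ⟨_, ⟨y₀, hy₀, rfl⟩, hproj⟩)
  · -- the excluded branch: `ι′_*⁻¹ res_⊤(range κ) ≤ ι′_*⁻¹ Q ≤ 𝔖_v(K, M′)`, finite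
    exfalso
    have hstrict : Q.comap (resH1Hom (ContinuousMonoidHom.id (⊤ : Subgroup (absoluteGaloisGroup K)))
        (V.endEigenPrimaryTorsion p π (1 - r)).subtype (fun _ _ ↦ rfl)) ≤
        (resOfLe ↥(V.endEigenPrimaryTorsion p π (1 - r)) (inf_le_left : ⊤ ⊓ decomp v ≤ ⊤)).ker :=
      (comap_le_map_proj V p π (1 - r) e' he'₁ he' Q).trans hB
    have hselB : Q.comap (resH1Hom (ContinuousMonoidHom.id (⊤ : Subgroup (absoluteGaloisGroup K)))
        (V.endEigenPrimaryTorsion p π (1 - r)).subtype (fun _ _ ↦ rfl)) ≤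
        restrictedSelmerBase ↥(V.endEigenPrimaryTorsion p π (1 - r)) p v :=
      le_restrictedSelmerBase_of_forall_not_mem_of_strict _ p v (fun w ↦ hK.2.isComplex w) _
        (fun w hw ↦ comap_sel_le_ker_resOfLe_of_not_mem V p π (1 - r) r (by rw [inf_comm]; exact hinf) (by rw [sup_comm]; exact hsup) w hw)
        hstrict
    have hKS : (((V.kummerMapPInfty p V.zsmul_geomPoints_surjective_holds).range).map (resSubgroup ⊤ (V.geomPrimaryTorsion p))).comap
        (resH1Hom (ContinuousMonoidHom.id _) (V.endEigenPrimaryTorsion p π (1 - r)).subtype (fun _ _ ↦ rfl)) ≤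
        Q.comap (resH1Hom (ContinuousMonoidHom.id (⊤ : Subgroup (absoluteGaloisGroup K)))
          (V.endEigenPrimaryTorsion p π (1 - r)).subtype (fun _ _ ↦ rfl)) := by
      refine AddSubgroup.comap_mono (AddSubgroup.map_mono ?_)
      rw [V.range_kummerMapPInfty p]
      exact V.ker_primaryH1ToH1_le_selmerGroupPInfty p
    haveI := hfin'
    exact hinf' (Finite.of_injective
      (fun x ↦ (⟨x.1, hselB (hKS x.2)⟩ : restrictedSelmerBase ↥(V.endEigenPrimaryTorsion p π (1 - r)) p v))
      (fun a b h ↦ Subtype.ext (by simpa using congrArg Subtype.val h)))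

omit [NumberField K] in
/-- **(INF′) from -w3 g9's (S) + (INF) for the Kummer image.** If the global Kummer image `Q = res_⊤(range κ)` is `ι_* e_*`-stable and
`e′_* Q` is infinite, then `ι′_*⁻¹ Q` is infinite (`e′_* Q ≤ ι′_*⁻¹ Q`, `map_proj_conj_le_comap_of_stable`): the projector-free form (INF′)
used by `sel_input_of_finite_conj`. [cite: SerreGaloisCohomology1997, I §2.4] [cite: Rubin1999, §2] -/
theorem not_finite_comap_conj_of_stable
    (e : V.geomPrimaryTorsion p →+ ↥(V.endEigenPrimaryTorsion p π r)) (e' : V.geomPrimaryTorsion p →+ ↥(V.endEigenPrimaryTorsion p π r'))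
    (he : ∀ (σ : absoluteGaloisGroup K) (x : V.geomPrimaryTorsion p), e (σ • x) = σ • e x)
    (he' : ∀ (σ : absoluteGaloisGroup K) (x : V.geomPrimaryTorsion p), e' (σ • x) = σ • e' x)
    (hsum : ∀ x, (e x : V.geomPrimaryTorsion p) + (e' x : V.geomPrimaryTorsion p) = x)
    (hQstab : ∀ q ∈ ((V.kummerMapPInfty p V.zsmul_geomPoints_surjective_holds).range).map (resSubgroup ⊤ (V.geomPrimaryTorsion p)),
      resH1Hom (ContinuousMonoidHom.id (⊤ : Subgroup (absoluteGaloisGroup K))) (V.endEigenPrimaryTorsion p π r).subtype (fun _ _ ↦ rfl)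
        (resH1Hom (ContinuousMonoidHom.id (⊤ : Subgroup (absoluteGaloisGroup K))) e (fun σ x ↦ he σ x) q) ∈
        ((V.kummerMapPInfty p V.zsmul_geomPoints_surjective_holds).range).map (resSubgroup ⊤ (V.geomPrimaryTorsion p)))
    (hQinf : ¬ Finite ↥((((V.kummerMapPInfty p V.zsmul_geomPoints_surjective_holds).range).map
        (resSubgroup ⊤ (V.geomPrimaryTorsion p))).map
        (resH1Hom (ContinuousMonoidHom.id (⊤ : Subgroup (absoluteGaloisGroup K))) e' (fun σ x ↦ he' σ x)))) :
    ¬ Finite ↥((((V.kummerMapPInfty p V.zsmul_geomPoints_surjective_holds).range).map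
        (resSubgroup ⊤ (V.geomPrimaryTorsion p))).comap
        (resH1Hom (ContinuousMonoidHom.id _) (V.endEigenPrimaryTorsion p π r').subtype (fun _ _ ↦ rfl))) := by
  intro hfin
  have hle := map_proj_conj_le_comap_of_stable V p π r r' e e' he he' hsum _ hQstab
  exact hQinf (Finite.of_injective (fun x ↦ (⟨x.1, hle x.2⟩ :
      ↥((((V.kummerMapPInfty p V.zsmul_geomPoints_surjective_holds).range).map (resSubgroup ⊤ (V.geomPrimaryTorsion p))).comap
        (resH1Hom (ContinuousMonoidHom.id _) (V.endEigenPrimaryTorsion p π r').subtype (fun _ _ ↦ rfl)))))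
    (fun a b h ↦ Subtype.ext (by simpa using congrArg Subtype.val h)))

end Generic

end Summit.BirchSwinnertonDyer.BirchSwinnertonDyer.Theorems.PrintCf2.CMPrimes

end
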